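import Mathlib.GroupTheory.SpecificGroups.Cyclic
import Literature.RepresentationTheory.FiniteGroups.StableLatticeReductionInvariantInt
import HarnessLib

/-!
# Additive invariants of finite `p`-torsion `ℤ[G]`-modules, I: the codimension-one splitting
# (the Herbrand identity `ψ (X[p]) = ψ (X/pX)` for ANY finite `X` is
# `StableLatticeReductionFiniteTorsion.additive_reduction_eq_torsionBy_of_finite`)

Topic `RepresentationTheory/FiniteGroups`; namespace `Literature.RepresentationTheory.FiniteGroups`
(sub-namespace `StableLatticeReduction.Int`, continued).  THEOREMS ONLY (no definition, no named
fact, no `sorry`, no instance).  Sequel of `StableLatticeReductionInvariantInt`: the same binder pair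
`(ψ, hψ)` — `ψ` any function on `ℤ`-linear `G`-representations, `hψ : ψ Y = ψ X + ψ Z` for short
exact `0 → X → Y → Z → 0` whose middle term is FINITE and KILLED BY `p` (the invariants of
arithmetic `M ↦ Σ (−1)ⁱ dim Hⁱ(G_S, A ⊗ M)` are additive exactly there).

Source (Milne, *Arithmetic Duality Theorems*, I §5, proof of Lemma 5.3, p. 69, verbatim): "Now
`[H³_S(K, M)] = [H⁴_S(K, M)]` because the Herbrand quotient of a finite module is `1`".  For the
invariant `X ↦ [X]` this is `[X[p]] = [X/pX]` for a finite `G`-module `X`, used in the proof of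
Thm. 5.1 (p. 70) for the FINITE groups `H¹(G_{L,S}, E_S)` (inside `Cl_S(L)`, not `p`-primary); the
file `StableLatticeReductionInvariant` proves it only for invariants additive on EVERY finite middle
term, which the invariants of the lane are not (`V ↦ V/pV` is not exact on
`0 → ℤ/p → ℤ/p² → ℤ/p → 0`).

## What is formalised (`G` a monoid, `p` a prime)

* (§1, the Herbrand identity `ψ (X[p]) = ψ (X/pX)` for every FINITE `X`, is NOT restated here: it is
  `StableLatticeReduction.Int.additive_reduction_eq_torsionBy_of_finite` of
  `StableLatticeReductionFiniteTorsion` — landed by a parallel seat of the lane minutes earlier;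
  a first version of this file carried a duplicate, withdrawn.)
* §2 **`additive_eq_add_trivial_of_card_quotient`** (universe `0`, the lane's setting) — a
  `G`-stable `Y ≤ P` of index `p` missed by a `G`-fixed vector splits off the trivial module:
  `ψ P = ψ Y + ψ (ℤ/p)`, with `ℤ/p` spelled `(Representation.trivial ℤ G ℤ).quotient (p • ⊤)` as
  in `EquivariantSUnitReduction` (the consumer's two hypotheses are COUNTS);
  §2′ `additive_eq_add_trivial_of_card_quotient'` — the same for a NON-canonical `Module ℤ P`
  instance (the lane's `ModuleCat` cohomology carriers) and the torsion hypothesis in `ℕ`-form.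

Written for lane «TATE-EPC-TC» of cell `bsd-eis` (road memo = evidence #54 on
stmt-BirchSwinnertonDyer-19032), brick B8 (the cyclic prime-to-`p` case of Tate's global
Euler–Poincaré characteristic at a totally complex field, Milne I Thm. 5.1), pieces «B8-ψalg»;
companion file: `PermutationModuleRecognition`.

## References
* J. S. Milne, *Arithmetic Duality Theorems*, 2nd ed. (2006), I Lemma 2.12, Lemma 5.3 and the proof
  of Thm. 5.1 (pp. 34, 69–70). [MilneADT2006]
* J.-P. Serre, *Linear Representations of Finite Groups*, GTM 42 (1977), §15.2 Thm. 32.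
  [SerreLinearRepresentations1977]
-/

namespace Literature.RepresentationTheory.FiniteGroups

namespace StableLatticeReduction.Int

open Function LinearMap Submodule StableLatticeReduction
open scoped Pointwise

variable {A : Type*} [AddCommGroup A] {p : ℕ}



/-! ### §2. Splitting off a trivial line (universe `0`, the lane's setting) -/

section AdditiveZero

variable {G : Type} [Monoid G]
variable (ψ : ∀ ⦃X : Type⦄ [AddCommGroup X] [Module ℤ X], Representation ℤ G X → A)
  (hψ : ∀ ⦃X Y Z : Type⦄ [AddCommGroup X] [Module ℤ X] [AddCommGroup Y] [Module ℤ Y]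
    [AddCommGroup Z] [Module ℤ Z] (ρX : Representation ℤ G X) (ρY : Representation ℤ G Y)
    (ρZ : Representation ℤ G Z) (f : X →ₗ[ℤ] Y) (g : Y →ₗ[ℤ] Z),
    (∀ s x, f (ρX s x) = ρY s (f x)) → (∀ s y, g (ρY s y) = ρZ s (g y)) →
    Injective f → Surjective g → LinearMap.range f = LinearMap.ker g → Finite Y →
    (∀ y : Y, (p : ℤ) • y = 0) → ψ ρY = ψ ρX + ψ ρZ)
include hψ

/-- **Codimension-one splitting.**  Let `P` be a finite `ℤ[G]`-module killed by `p`, `Y ≤ P` a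
`G`-stable submodule of index `p`, and suppose some `G`-FIXED vector of `P` lies outside `Y`.  Then
`P/Y` is the trivial module `ℤ/p` (a group of prime order generated by the class of the fixed
vector, on which `G` therefore acts trivially), so `ψ P = ψ Y + ψ (ℤ/p)` — with `ℤ/p` spelled
`(Representation.trivial ℤ G ℤ).quotient (p • ⊤)` as in `EquivariantSUnitReduction`.  (Lane use:
`P = H²(J_S)[p]`, `Y = H²(E_S)[p]`; the two hypotheses are COUNTS.)
[cite: MilneADT2006, I §5, proof of Thm. 5.1 (p. 70)] [cite: SerreLinearRepresentations1977, §15.2 Thm. 32] -/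
theorem additive_eq_add_trivial_of_card_quotient [hp : Fact p.Prime] {P : Type} [AddCommGroup P]
    [Finite P] (ρ : Representation ℤ G P) (hP : ∀ x : P, (p : ℤ) • x = 0) (Y : Submodule ℤ P)
    (hY : ∀ s, Y ≤ Y.comap (ρ s)) (hcard : Nat.card (P ⧸ Y) = p)
    (hfix : ∃ x : P, (∀ s, ρ s x = x) ∧ x ∉ Y) :
    ψ ρ = ψ (ρ.subrepresentation Y hY) +
      ψ ((Representation.trivial ℤ G ℤ).quotient ((p : ℤ) • ⊤)
        (smul_top_le_comap (Representation.trivial ℤ G ℤ) (p : ℤ))) := by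
  obtain ⟨good_sub, good_quot, hψ'⟩ := admissible ψ hψ
  obtain ⟨x₀, hx₀, hx₀Y⟩ := hfix
  have goodP : Finite P ∧ ∀ x : P, (p : ℤ) • x = 0 := ⟨inferInstance, hP⟩
  have hmem : ∀ {W : Type} [AddCommGroup W] (y : W), y ∈ ((p : ℤ) • ⊤ : Submodule ℤ W) ↔
      ∃ z : W, (p : ℤ) • z = y := fun y => by
    rw [mem_smul_pointwise_iff_exists]
    exact ⟨fun ⟨z, _, h⟩ => ⟨z, h⟩, fun ⟨z, h⟩ => ⟨z, mem_top, h⟩⟩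
  -- the class `q₀ = [x₀]` generates the group `P/Y` of prime order
  let q₀ : P ⧸ Y := Submodule.Quotient.mk x₀
  have hq₀ : q₀ ≠ 0 := fun h => hx₀Y ((Submodule.Quotient.mk_eq_zero Y).1 h)
  haveI : Fact (Nat.card (P ⧸ Y)).Prime := ⟨hcard.symm ▸ hp.out⟩
  have hgen : ∀ q : P ⧸ Y, ∃ n : ℤ, n • q₀ = q := fun q => by
    have htop : AddSubgroup.zmultiples q₀ = ⊤ :=
      ((AddSubgroup.zmultiples q₀).eq_bot_or_eq_top_of_prime_card).resolve_left
        (fun h => hq₀ ((AddSubgroup.zmultiples_eq_bot).1 h))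
    exact (AddSubgroup.mem_zmultiples_iff).1 (htop.symm ▸ AddSubgroup.mem_top q)
  have hord : addOrderOf q₀ = p := by
    rcases (Nat.dvd_prime hp.out).1 (hcard ▸ addOrderOf_dvd_natCard q₀) with h | h
    · exact absurd (AddMonoid.addOrderOf_eq_one_iff.1 h) hq₀
    · exact h
  -- `ℤ/p → P/Y`, `[n] ↦ [n • x₀] = n • q₀`
  have hmk : ∀ n : ℤ, (Submodule.Quotient.mk (n • x₀) : P ⧸ Y) = n • q₀ := fun n =>
    map_zsmul (Submodule.mkQ Y) n x₀
  let f₀ : ℤ →ₗ[ℤ] P ⧸ Y := Y.mkQ ∘ₗ LinearMap.toSpanSingleton ℤ P x₀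
  have hf₀ : ∀ n : ℤ, f₀ n = Submodule.Quotient.mk (n • x₀) := fun n => rfl
  have hker : ((p : ℤ) • ⊤ : Submodule ℤ ℤ) ≤ LinearMap.ker f₀ := by
    intro n hn
    obtain ⟨m, rfl⟩ := (hmem n).1 hn
    rw [LinearMap.mem_ker, hf₀, smul_eq_mul, mul_comm, mul_smul, hP x₀, smul_zero,
      Submodule.Quotient.mk_zero]
  let f : (ℤ ⧸ ((p : ℤ) • ⊤ : Submodule ℤ ℤ)) →ₗ[ℤ] P ⧸ Y := Submodule.liftQ _ f₀ hker
  have hfmk : ∀ n : ℤ, f (Submodule.Quotient.mk n) = Submodule.Quotient.mk (n • x₀) := fun n => rfl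
  have hfsurj : Surjective f := fun q => by
    obtain ⟨n, hn⟩ := hgen q
    exact ⟨Submodule.Quotient.mk n, ((hfmk n).trans (hmk n)).trans hn⟩
  have hfinj : Injective f := by
    rw [← LinearMap.ker_eq_bot, eq_bot_iff]
    intro c hc
    obtain ⟨n, rfl⟩ := mkQ_surjective _ c
    rw [LinearMap.mem_ker] at hc
    have hc' : n • q₀ = 0 := ((hmk n).symm.trans ((hfmk n).symm)).trans hc
    rw [← addOrderOf_dvd_iff_zsmul_eq_zero, hord] at hc'
    obtain ⟨m, rfl⟩ := hc'
    rw [Submodule.mem_bot]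
    exact (Submodule.Quotient.mk_eq_zero _).2 ((hmem _).2 ⟨m, by rw [smul_eq_mul]⟩)
  let e : (ℤ ⧸ ((p : ℤ) • ⊤ : Submodule ℤ ℤ)) ≃ₗ[ℤ] P ⧸ Y :=
    LinearEquiv.ofBijective f ⟨hfinj, hfsurj⟩
  have he : ∀ s c, e (((Representation.trivial ℤ G ℤ).quotient ((p : ℤ) • ⊤)
      (smul_top_le_comap (Representation.trivial ℤ G ℤ) (p : ℤ))) s c) =
      (ρ.quotient Y hY) s (e c) := fun s c => by
    obtain ⟨n, rfl⟩ := mkQ_surjective _ c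
    change (Submodule.Quotient.mk (n • x₀) : P ⧸ Y) = Submodule.Quotient.mk (ρ s (n • x₀))
    rw [map_zsmul, hx₀ s]
  rw [Admissible.additive_eq_sub_add_quotient ψ _ hψ' ρ goodP Y hY]
  congr 1
  exact (Admissible.additive_eq_of_linearEquiv ψ _ good_quot hψ' _ (ρ.quotient Y hY)
    (good_quot ρ Y hY goodP) e he).symm

end AdditiveZero

/-! ### §2′. The same, for a NON-canonical `Module ℤ` structure and `p`-torsion in `ℕ`-form

The cohomology carriers of the lane (`continuousCohomology n _`, a `ModuleCat` carrier) come with a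
`Module ℤ` instance that is not definitionally `AddCommGroup.toIntModule`; the version below takes
the instance as a binder (and `ψ` with strict-implicit instance binders — the same Π-type as the
binder of `StableLatticeReductionInvariantInt`, so the lane's `(ψ, hψ)` is accepted verbatim) and
the torsion hypothesis in the canonical `ℕ`-scalar form `p • x = 0`. -/

section InstancePolymorphic

variable {G : Type} [Monoid G]
variable (ψ : ∀ ⦃X : Type⦄ ⦃_ : AddCommGroup X⦄ ⦃_ : Module ℤ X⦄, Representation ℤ G X → A)
  (hψ : ∀ ⦃X Y Z : Type⦄ [AddCommGroup X] [Module ℤ X] [AddCommGroup Y] [Module ℤ Y]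
    [AddCommGroup Z] [Module ℤ Z] (ρX : Representation ℤ G X) (ρY : Representation ℤ G Y)
    (ρZ : Representation ℤ G Z) (f : X →ₗ[ℤ] Y) (g : Y →ₗ[ℤ] Z),
    (∀ s x, f (ρX s x) = ρY s (f x)) → (∀ s y, g (ρY s y) = ρZ s (g y)) →
    Injective f → Surjective g → LinearMap.range f = LinearMap.ker g → Finite Y →
    (∀ y : Y, (p : ℤ) • y = 0) → ψ ρY = ψ ρX + ψ ρZ)
include hψ

/-- **Codimension-one splitting, instance-polymorphic form** of
`additive_eq_add_trivial_of_card_quotient`: the `Module ℤ P` structure is an arbitrary instance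
binder (e.g. the `isModule` field of a `ModuleCat` carrier) and the torsion hypothesis is `p • x = 0`
with the canonical `ℕ`-action.  Proof: `Module ℤ P` is a subsingleton, so one may substitute the
canonical structure and apply the previous theorem.
[cite: MilneADT2006, I §5, proof of Thm. 5.1 (p. 70)] [cite: SerreLinearRepresentations1977, §15.2 Thm. 32] -/
theorem additive_eq_add_trivial_of_card_quotient' [hp : Fact p.Prime] {P : Type} [AddCommGroup P]
    [instP : Module ℤ P] [Finite P] (ρ : Representation ℤ G P) (hP : ∀ x : P, p • x = 0)
    (Y : Submodule ℤ P) (hY : ∀ s, Y ≤ Y.comap (ρ s)) (hcard : Nat.card (P ⧸ Y) = p)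
    (hfix : ∃ x : P, (∀ s, ρ s x = x) ∧ x ∉ Y) :
    ψ ρ = ψ (ρ.subrepresentation Y hY) +
      ψ ((Representation.trivial ℤ G ℤ).quotient ((p : ℤ) • ⊤)
        (smul_top_le_comap (Representation.trivial ℤ G ℤ) (p : ℤ))) := by
  cases Subsingleton.elim instP (AddCommGroup.toIntModule P)
  have hP' : ∀ x : P, (p : ℤ) • x = 0 := fun x => (Nat.cast_smul_eq_nsmul ℤ p x).trans (hP x)
  exact additive_eq_add_trivial_of_card_quotient ψ hψ ρ hP' Y hY hcard hfix

end InstancePolymorphic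

end StableLatticeReduction.Int

end Literature.RepresentationTheory.FiniteGroups
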